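import Mathlib
import Summits.NavierStokesRegularity.OSWSelfSimilar.SheetNSLineTorusCascadeSuperTail
import Literature.Analysis.Fourier.HilbertTransformCircleSeries
import HarnessLib

/-!
# Viscous CLM on the torus (`a = 0`, `σ = 2`): SYNTHESIS, part 1 — the sine series built on a geometrically bounded sine
# cascade and its termwise calculus (space and time derivatives, joint continuity, periodicity)

HONEST FRAMING (cell ns-blowup GROUP B «PROFILE SEARCH», zone Z3, row Z3-U addendum A-F2 of `HOME/profile/z3/CENSUS-Z3.md`;
human rulings D-0035/D-0074): **1-D MODEL (viscous Constantin–Lax–Majda equation `ω_t = ω·Hω + ν ω_xx` on `𝕋`,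
`H = hilbertTransformCircle`); series calculus, kernel-checked; not Euler, not Navier–Stokes; «violates: none — MODEL».**

This is the CONVERSE direction of the PDE ↔ cascade dictionary (pen gap (g2)): from a global sine cascade `IsSineCascade ν c e`
whose modes obey a GEOMETRIC ENVELOPE `|e_k(t)| ≤ A·k·q^k` (`0 ≤ q < 1`, all `t ≥ 0` — e.g. the stationary-pole bound
`e_k ≤ 12νk(c/12ν)^k` of `mode_le_stationaryPole` for `c < 12ν`, or a certificate's moving-pole bound) we BUILD the functions
`ω(t,x) = −Σ_k e_k(t⁺) sin kx` (`t⁺ = max(t,0)`), `ωx`, `ωxx`, `ωt` as absolutely convergent series and prove the termwise facts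
the sequel (`SheetNSLineTorusCascadeSynthesis`) assembles into a classical solution:

* `synthOmega`, `synthOmegaX`, `synthOmegaXX`, `synthRhs`, `synthOmegaT` — the series (clamped at `t = 0` so that they are
  globally defined and continuous); `abs_clamp_le` and the common summable majorant `C·k³·q^k` (`majorant`, `summable_majorant`,
  the four `abs_…_term_le`);
* `hasDerivAt_synthOmega_x`, `hasDerivAt_synthOmegaX_x` — termwise `x`-derivatives (`hasDerivAt_tsum`);
  `continuous_synthOmegaXX`, `continuous_uncurry_synthOmega`, `continuous_uncurry_synthOmegaT` — (joint) continuity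
  (`continuous_tsum`); `hasDerivAt_synthOmega_t` — termwise time derivative on `t > 0` (`hasDerivAt_tsum_of_isPreconnected`,
  the cascade (C) supplying the derivative of each mode); `synthOmega_periodic`;
bears_on: LADDER-NS N5 / zone Z3 (row Z3-U, A-F2) → N1 linear core. WHAT THIS IS NOT: not NS; no statement about the threshold;
the Hilbert transform of the series, the product `ω·Hω`, the PDE verification and the existence theorem are in the sequel.
-/

noncomputable section

namespace Summit.NavierStokesRegularity.OSWSelfSimilar
namespace SheetNSLineTorusCascade

open Finset Real Set Filter MeasureTheory Complex
open Literature.Analysis.Fourier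
open scoped Topology

/-! ### The series -/

/-- `ω(t,x) = −Σ_k e_k(t⁺) sin(kx)` (`t⁺ = max(t,0)`). [new here — MODEL] -/
def synthOmega (e : ℕ → ℝ → ℝ) (t x : ℝ) : ℝ := -∑' k : ℕ, e k (max t 0) * Real.sin ((k : ℝ) * x)

/-- `ωx(t,x) = −Σ_k e_k(t⁺) k cos(kx)`. [new here — MODEL] -/
def synthOmegaX (e : ℕ → ℝ → ℝ) (t x : ℝ) : ℝ := -∑' k : ℕ, e k (max t 0) * ((k : ℝ) * Real.cos ((k : ℝ) * x))

/-- `ωxx(t,x) = Σ_k e_k(t⁺) k² sin(kx)`. [new here — MODEL] -/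
def synthOmegaXX (e : ℕ → ℝ → ℝ) (t x : ℝ) : ℝ := ∑' k : ℕ, e k (max t 0) * ((k : ℝ) ^ 2 * Real.sin ((k : ℝ) * x))

/-- The cascade right-hand side at the clamped time: `½ Σ_{i+j=k} e_i e_j − ν k² e_k` at `t⁺`. [new here — MODEL] -/
def synthRhs (ν : ℝ) (e : ℕ → ℝ → ℝ) (k : ℕ) (t : ℝ) : ℝ :=
  (1 / 2) * (∑ p ∈ antidiagonal k, e p.1 (max t 0) * e p.2 (max t 0)) - ν * (k : ℝ) ^ 2 * e k (max t 0)

/-- `ωt(t,x) = −Σ_k (½ Σ_{i+j=k} e_i e_j − ν k² e_k)(t⁺) sin(kx)`. [new here — MODEL] -/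
def synthOmegaT (ν : ℝ) (e : ℕ → ℝ → ℝ) (t x : ℝ) : ℝ := -∑' k : ℕ, synthRhs ν e k t * Real.sin ((k : ℝ) * x)

/-- The common majorant `C·k³·q^k` with `C = A + A²/12 + |ν|·A`. [new here — MODEL] -/
def majorant (ν A q : ℝ) (k : ℕ) : ℝ := (A + A ^ 2 / 12 + |ν| * A) * ((k : ℝ) ^ 3 * q ^ k)

variable {ν c A q : ℝ} {e : ℕ → ℝ → ℝ}

/-! ### Bounds (explicit parameters; no cascade structure needed) -/

/-- `k ≤ k³` for naturals, in `ℝ`. -/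
private theorem cast_le_pow_three (k : ℕ) : (k : ℝ) ≤ (k : ℝ) ^ 3 := by
  exact_mod_cast Nat.le_self_pow (by norm_num) k

/-- `k·k ≤ k³` for naturals, in `ℝ`. -/
private theorem cast_mul_le_pow_three (k : ℕ) : (k : ℝ) * k ≤ (k : ℝ) ^ 3 := by
  rcases Nat.eq_zero_or_pos k with h0 | h0
  · simp [h0]
  · have h1 : (1 : ℝ) ≤ k := by exact_mod_cast h0
    have hk : (0 : ℝ) ≤ k := Nat.cast_nonneg k
    calc (k : ℝ) * k = k * k * 1 := by ring
      _ ≤ k * k * k := by gcongr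
      _ = (k : ℝ) ^ 3 := by ring

/-- The clamped modes obey the envelope at every real time. -/
theorem abs_clamp_le (hb : ∀ k : ℕ, ∀ t : ℝ, 0 ≤ t → |e k t| ≤ A * k * q ^ k) (k : ℕ) (t : ℝ) :
    |e k (max t 0)| ≤ A * k * q ^ k := hb k _ (le_max_right _ _)

/-- The majorant is summable (`Σ k³ q^k < ∞` for `0 ≤ q < 1`). -/
theorem summable_majorant (ν A : ℝ) (hq : 0 ≤ q) (hq1 : q < 1) : Summable (majorant ν A q) := by
  unfold majorant
  refine Summable.mul_left _ ?_
  exact summable_pow_mul_geometric_of_norm_lt_one 3 (show ‖q‖ < 1 by rwa [Real.norm_of_nonneg hq])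

/-- The constant of the majorant dominates `A`. -/
private theorem le_majorantConst (ν : ℝ) (hA : 0 ≤ A) : A ≤ A + A ^ 2 / 12 + |ν| * A := by
  nlinarith [abs_nonneg ν, sq_nonneg A]

/-- `A k q^k ≤ majorant ν A q k`. -/
private theorem base_le_majorant (ν : ℝ) (hA : 0 ≤ A) (hq : 0 ≤ q) (k : ℕ) : A * k * q ^ k ≤ majorant ν A q k := by
  unfold majorant
  have hqk : 0 ≤ q ^ k := pow_nonneg hq k
  calc A * k * q ^ k = A * (k * q ^ k) := by ring
    _ ≤ (A + A ^ 2 / 12 + |ν| * A) * ((k : ℝ) ^ 3 * q ^ k) := by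
        gcongr
        · exact le_majorantConst ν hA
        · exact cast_le_pow_three k

/-- `|e_k(t⁺) sin(kx)| ≤ majorant ν A q k`. -/
theorem abs_omega_term_le (ν : ℝ) (hA : 0 ≤ A) (hq : 0 ≤ q)
    (hb : ∀ k : ℕ, ∀ t : ℝ, 0 ≤ t → |e k t| ≤ A * k * q ^ k) (k : ℕ) (t x : ℝ) :
    |e k (max t 0) * Real.sin ((k : ℝ) * x)| ≤ majorant ν A q k := by
  rw [abs_mul]
  have hqk : 0 ≤ q ^ k := pow_nonneg hq k
  calc |e k (max t 0)| * |Real.sin ((k : ℝ) * x)| ≤ A * k * q ^ k * 1 :=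
        mul_le_mul (abs_clamp_le hb k t) (Real.abs_sin_le_one _) (abs_nonneg _) (by positivity)
    _ ≤ majorant ν A q k := by rw [mul_one]; exact base_le_majorant ν hA hq k

/-- `|e_k(t⁺) cos(kx)| ≤ majorant ν A q k`. -/
theorem abs_cos_term_le (ν : ℝ) (hA : 0 ≤ A) (hq : 0 ≤ q)
    (hb : ∀ k : ℕ, ∀ t : ℝ, 0 ≤ t → |e k t| ≤ A * k * q ^ k) (k : ℕ) (t x : ℝ) :
    |e k (max t 0) * Real.cos ((k : ℝ) * x)| ≤ majorant ν A q k := by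
  rw [abs_mul]
  have hqk : 0 ≤ q ^ k := pow_nonneg hq k
  calc |e k (max t 0)| * |Real.cos ((k : ℝ) * x)| ≤ A * k * q ^ k * 1 :=
        mul_le_mul (abs_clamp_le hb k t) (Real.abs_cos_le_one _) (abs_nonneg _) (by positivity)
    _ ≤ majorant ν A q k := by rw [mul_one]; exact base_le_majorant ν hA hq k

/-- `|e_k(t⁺) k cos(kx)| ≤ majorant ν A q k`. -/
theorem abs_omegaX_term_le (ν : ℝ) (hA : 0 ≤ A) (hq : 0 ≤ q)
    (hb : ∀ k : ℕ, ∀ t : ℝ, 0 ≤ t → |e k t| ≤ A * k * q ^ k) (k : ℕ) (t x : ℝ) :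
    |e k (max t 0) * ((k : ℝ) * Real.cos ((k : ℝ) * x))| ≤ majorant ν A q k := by
  rw [abs_mul, abs_mul, Nat.abs_cast]
  have hqk : 0 ≤ q ^ k := pow_nonneg hq k
  have hk0 : (0 : ℝ) ≤ k := Nat.cast_nonneg k
  calc |e k (max t 0)| * ((k : ℝ) * |Real.cos ((k : ℝ) * x)|) ≤ A * k * q ^ k * ((k : ℝ) * 1) :=
        mul_le_mul (abs_clamp_le hb k t) (mul_le_mul_of_nonneg_left (Real.abs_cos_le_one _) hk0)
          (by positivity) (by positivity)
    _ = A * ((k * k) * q ^ k) := by ring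
    _ ≤ (A + A ^ 2 / 12 + |ν| * A) * ((k : ℝ) ^ 3 * q ^ k) := by
        gcongr
        · exact le_majorantConst ν hA
        · exact cast_mul_le_pow_three k
    _ = majorant ν A q k := rfl

/-- `|e_k(t⁺) k² sin(kx)| ≤ majorant ν A q k`. -/
theorem abs_omegaXX_term_le (ν : ℝ) (hA : 0 ≤ A) (hq : 0 ≤ q)
    (hb : ∀ k : ℕ, ∀ t : ℝ, 0 ≤ t → |e k t| ≤ A * k * q ^ k) (k : ℕ) (t x : ℝ) :
    |e k (max t 0) * ((k : ℝ) ^ 2 * Real.sin ((k : ℝ) * x))| ≤ majorant ν A q k := by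
  rw [abs_mul, abs_mul, abs_of_nonneg (by positivity : (0 : ℝ) ≤ (k : ℝ) ^ 2)]
  have hqk : 0 ≤ q ^ k := pow_nonneg hq k
  have hk0 : (0 : ℝ) ≤ (k : ℝ) ^ 2 := by positivity
  calc |e k (max t 0)| * ((k : ℝ) ^ 2 * |Real.sin ((k : ℝ) * x)|) ≤ A * k * q ^ k * ((k : ℝ) ^ 2 * 1) :=
        mul_le_mul (abs_clamp_le hb k t) (mul_le_mul_of_nonneg_left (Real.abs_sin_le_one _) hk0)
          (by positivity) (by positivity)
    _ = A * ((k : ℝ) ^ 3 * q ^ k) := by ring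
    _ ≤ (A + A ^ 2 / 12 + |ν| * A) * ((k : ℝ) ^ 3 * q ^ k) := by
        gcongr
        exact le_majorantConst ν hA
    _ = majorant ν A q k := rfl

/-- The convolution at the clamped time: `|Σ_{i+j=k} e_i e_j| ≤ A² q^k (k³ − k)/6`. -/
theorem abs_conv_le (hA : 0 ≤ A) (hq : 0 ≤ q)
    (hb : ∀ k : ℕ, ∀ t : ℝ, 0 ≤ t → |e k t| ≤ A * k * q ^ k) (k : ℕ) (t : ℝ) :
    |∑ p ∈ antidiagonal k, e p.1 (max t 0) * e p.2 (max t 0)| ≤ A ^ 2 * q ^ k * (((k : ℝ) ^ 3 - k) / 6) := by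
  calc |∑ p ∈ antidiagonal k, e p.1 (max t 0) * e p.2 (max t 0)|
      ≤ ∑ p ∈ antidiagonal k, |e p.1 (max t 0) * e p.2 (max t 0)| := abs_sum_le_sum_abs _ _
    _ ≤ ∑ p ∈ antidiagonal k, (A * p.1 * q ^ p.1) * (A * p.2 * q ^ p.2) := by
        refine sum_le_sum fun p _ => ?_
        rw [abs_mul]
        have h2 : 0 ≤ q ^ p.1 := pow_nonneg hq _
        exact mul_le_mul (abs_clamp_le hb p.1 t) (abs_clamp_le hb p.2 t) (abs_nonneg _) (by positivity)
    _ = A ^ 2 * q ^ k * ∑ p ∈ antidiagonal k, (p.1 : ℝ) * (p.2 : ℝ) := by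
        rw [mul_sum]
        refine sum_congr rfl fun p hp => ?_
        have hsum : p.1 + p.2 = k := mem_antidiagonal.mp hp
        rw [← hsum, pow_add]
        ring
    _ = A ^ 2 * q ^ k * (((k : ℝ) ^ 3 - k) / 6) := by rw [antidiagonal_sum_mul_cast]

/-- `|synthRhs ν e k t| ≤ (A²/12 + |ν| A) k³ q^k`. -/
theorem abs_synthRhs_le (hA : 0 ≤ A) (hq : 0 ≤ q)
    (hb : ∀ k : ℕ, ∀ t : ℝ, 0 ≤ t → |e k t| ≤ A * k * q ^ k) (k : ℕ) (t : ℝ) :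
    |synthRhs ν e k t| ≤ (A ^ 2 / 12 + |ν| * A) * ((k : ℝ) ^ 3 * q ^ k) := by
  have hqk : 0 ≤ q ^ k := pow_nonneg hq k
  have hk0 : (0 : ℝ) ≤ k := Nat.cast_nonneg k
  have hk3 : (0 : ℝ) ≤ (k : ℝ) ^ 3 - k := sub_nonneg.mpr (cast_le_pow_three k)
  unfold synthRhs
  calc |1 / 2 * (∑ p ∈ antidiagonal k, e p.1 (max t 0) * e p.2 (max t 0)) - ν * (k : ℝ) ^ 2 * e k (max t 0)|
      ≤ |1 / 2 * (∑ p ∈ antidiagonal k, e p.1 (max t 0) * e p.2 (max t 0))| + |ν * (k : ℝ) ^ 2 * e k (max t 0)| :=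
        abs_sub _ _
    _ ≤ 1 / 2 * (A ^ 2 * q ^ k * (((k : ℝ) ^ 3 - k) / 6)) + |ν| * (k : ℝ) ^ 2 * (A * k * q ^ k) := by
        rw [abs_mul, abs_mul, abs_mul, abs_of_pos (by norm_num : (0:ℝ) < 1 / 2),
          abs_of_nonneg (by positivity : (0:ℝ) ≤ (k : ℝ) ^ 2)]
        gcongr
        · exact abs_conv_le hA hq hb k t
        · exact abs_clamp_le hb k t
    _ ≤ (A ^ 2 / 12 + |ν| * A) * ((k : ℝ) ^ 3 * q ^ k) := by
        have hA2 : 0 ≤ A ^ 2 * q ^ k := by positivity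
        nlinarith [abs_nonneg ν]

/-- `|synthRhs ν e k t · sin(kx)| ≤ majorant ν A q k`. -/
theorem abs_omegaT_term_le (hA : 0 ≤ A) (hq : 0 ≤ q)
    (hb : ∀ k : ℕ, ∀ t : ℝ, 0 ≤ t → |e k t| ≤ A * k * q ^ k) (k : ℕ) (t x : ℝ) :
    |synthRhs ν e k t * Real.sin ((k : ℝ) * x)| ≤ majorant ν A q k := by
  have hR := abs_synthRhs_le (ν := ν) hA hq hb k t
  have hqk : 0 ≤ q ^ k := pow_nonneg hq k
  have hC0 : 0 ≤ (A ^ 2 / 12 + |ν| * A) * ((k : ℝ) ^ 3 * q ^ k) := by positivity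
  rw [abs_mul]
  calc |synthRhs ν e k t| * |Real.sin ((k : ℝ) * x)| ≤ (A ^ 2 / 12 + |ν| * A) * ((k : ℝ) ^ 3 * q ^ k) * 1 :=
        mul_le_mul hR (Real.abs_sin_le_one _) (abs_nonneg _) hC0
    _ ≤ majorant ν A q k := by
        unfold majorant
        rw [mul_one]
        have : A ^ 2 / 12 + |ν| * A ≤ A + A ^ 2 / 12 + |ν| * A := by linarith
        exact mul_le_mul_of_nonneg_right this (by positivity)

section envelope

variable (he : IsSineCascade ν c e) (hA : 0 ≤ A) (hq : 0 ≤ q) (hq1 : q < 1)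
  (hb : ∀ k : ℕ, ∀ t : ℝ, 0 ≤ t → |e k t| ≤ A * k * q ^ k)
include he hA hq hq1 hb

/-! ### Continuity of the clamped modes -/

omit hA hq hq1 hb in
/-- Each clamped mode `t ↦ e_k(t⁺)` is continuous on `ℝ`. -/
theorem continuous_clamp (k : ℕ) : Continuous fun t : ℝ => e k (max t 0) :=
  (he.cont k).comp_continuous (f := fun t : ℝ => max t 0) (continuous_id.max continuous_const)
    fun t => Set.mem_Ici.mpr (le_max_right t 0)

omit hA hq hq1 hb in
/-- Each `synthRhs k` is continuous on `ℝ`. -/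
theorem continuous_synthRhs (k : ℕ) : Continuous (synthRhs ν e k) := by
  unfold synthRhs
  refine (continuous_const.mul (continuous_finsetSum _ fun p _ => ?_)).sub
    (continuous_const.mul (continuous_clamp he k))
  exact (continuous_clamp he p.1).mul (continuous_clamp he p.2)

/-! ### Termwise calculus -/

omit he in
/-- **`∂_x ω = ωx`**, termwise. [new here — MODEL] -/
theorem hasDerivAt_synthOmega_x (t x : ℝ) : HasDerivAt (synthOmega e t) (synthOmegaX e t x) x := by
  unfold synthOmega synthOmegaX
  have h := hasDerivAt_tsum (u := majorant 0 A q) (g := fun (k : ℕ) (y : ℝ) => e k (max t 0) * Real.sin ((k : ℝ) * y))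
    (g' := fun (k : ℕ) (y : ℝ) => e k (max t 0) * ((k : ℝ) * Real.cos ((k : ℝ) * y))) (y₀ := 0)
    (summable_majorant 0 A hq hq1) (fun k y => ?_) (fun k y => ?_) ?_ x
  · exact h.neg
  · have h1 : HasDerivAt (fun y : ℝ => Real.sin ((k : ℝ) * y)) ((k : ℝ) * Real.cos ((k : ℝ) * y)) y := by
      have := ((hasDerivAt_id y).const_mul (k : ℝ)).sin
      simpa [mul_comm] using this
    exact h1.const_mul _
  · rw [Real.norm_eq_abs]; exact abs_omegaX_term_le 0 hA hq hb k t y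
  · simp [summable_zero]

omit he in
/-- **`∂_x ωx = ωxx`**, termwise. [new here — MODEL] -/
theorem hasDerivAt_synthOmegaX_x (t x : ℝ) : HasDerivAt (synthOmegaX e t) (synthOmegaXX e t x) x := by
  unfold synthOmegaX synthOmegaXX
  have h := hasDerivAt_tsum (u := majorant 0 A q)
    (g := fun (k : ℕ) (y : ℝ) => e k (max t 0) * ((k : ℝ) * Real.cos ((k : ℝ) * y)))
    (g' := fun (k : ℕ) (y : ℝ) => -(e k (max t 0) * ((k : ℝ) ^ 2 * Real.sin ((k : ℝ) * y)))) (y₀ := 0)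
    (summable_majorant 0 A hq hq1) (fun k y => ?_) (fun k y => ?_) ?_ x
  · have h2 := h.neg
    simp only [tsum_neg, neg_neg] at h2
    exact h2
  · have h1 : HasDerivAt (fun y : ℝ => (k : ℝ) * Real.cos ((k : ℝ) * y)) (-((k : ℝ) ^ 2 * Real.sin ((k : ℝ) * y))) y := by
      have := (((hasDerivAt_id y).const_mul (k : ℝ)).cos).const_mul (k : ℝ)
      refine this.congr_deriv ?_
      simp only [id, mul_one]; ring
    have h3 := h1.const_mul (e k (max t 0))
    refine h3.congr_deriv ?_
    ring
  · rw [norm_neg, Real.norm_eq_abs]; exact abs_omegaXX_term_le 0 hA hq hb k t y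
  · exact (summable_majorant 0 A hq hq1).of_norm_bounded (fun k => by
      rw [Real.norm_eq_abs]; exact abs_omegaX_term_le 0 hA hq hb k t 0)

omit he in
/-- `ωxx(t,·)` is continuous. -/
theorem continuous_synthOmegaXX (t : ℝ) : Continuous (synthOmegaXX e t) := by
  unfold synthOmegaXX
  exact continuous_tsum (u := majorant 0 A q) (fun k => by fun_prop) (summable_majorant 0 A hq hq1)
    fun k x => by rw [Real.norm_eq_abs]; exact abs_omegaXX_term_le 0 hA hq hb k t x

/-- `ω` is jointly continuous on `ℝ × ℝ`. -/
theorem continuous_uncurry_synthOmega : Continuous (Function.uncurry (synthOmega e)) := by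
  have h : Continuous fun p : ℝ × ℝ => ∑' k : ℕ, e k (max p.1 0) * Real.sin ((k : ℝ) * p.2) :=
    continuous_tsum (u := majorant ν A q) (fun k => ((continuous_clamp he k).comp continuous_fst).mul (by fun_prop))
      (summable_majorant ν A hq hq1) fun k p => by rw [Real.norm_eq_abs]; exact abs_omega_term_le ν hA hq hb k p.1 p.2
  exact h.neg

/-- `ωt` is jointly continuous on `ℝ × ℝ`. -/
theorem continuous_uncurry_synthOmegaT : Continuous (Function.uncurry (synthOmegaT ν e)) := by
  have h : Continuous fun p : ℝ × ℝ => ∑' k : ℕ, synthRhs ν e k p.1 * Real.sin ((k : ℝ) * p.2) :=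
    continuous_tsum (u := majorant ν A q) (fun k => ((continuous_synthRhs he k).comp continuous_fst).mul (by fun_prop))
      (summable_majorant ν A hq hq1) fun k p => by rw [Real.norm_eq_abs]; exact abs_omegaT_term_le hA hq hb k p.1 p.2
  exact h.neg

/-- **`∂_t ω = ωt` for `t > 0`**, termwise, the cascade (C) supplying each mode's derivative. [new here — MODEL] -/
theorem hasDerivAt_synthOmega_t {t : ℝ} (ht : 0 < t) (x : ℝ) :
    HasDerivAt (fun s => synthOmega e s x) (synthOmegaT ν e t x) t := by
  unfold synthOmega synthOmegaT
  have h := hasDerivAt_tsum_of_isPreconnected (u := majorant ν A q) (t := Ioi (0 : ℝ))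
    (g := fun (k : ℕ) (s : ℝ) => e k (max s 0) * Real.sin ((k : ℝ) * x))
    (g' := fun (k : ℕ) (s : ℝ) => synthRhs ν e k s * Real.sin ((k : ℝ) * x)) (y₀ := 1)
    (summable_majorant ν A hq hq1) isOpen_Ioi isPreconnected_Ioi (fun k s hs => ?_) (fun k s _ => ?_)
    (by norm_num) ?_ ht
  · exact h.neg
  · -- on `s > 0` the clamp is the identity near `s`, and (C) gives the derivative
    have hs : (0 : ℝ) < s := hs
    have heq : (fun r : ℝ => e k (max r 0)) =ᶠ[𝓝 s] e k := by
      filter_upwards [Ioi_mem_nhds hs] with r hr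
      rw [max_eq_left (le_of_lt hr)]
    have h1 : HasDerivAt (fun r : ℝ => e k (max r 0))
        ((1 / 2) * (∑ p ∈ antidiagonal k, e p.1 s * e p.2 s) - ν * (k : ℝ) ^ 2 * e k s) s :=
      (he.ode k s hs).congr_of_eventuallyEq heq
    have h2 := h1.mul_const (Real.sin ((k : ℝ) * x))
    refine h2.congr_deriv ?_
    simp only [synthRhs, max_eq_left hs.le]
  · rw [Real.norm_eq_abs]; exact abs_omegaT_term_le hA hq hb k s x
  · exact (summable_majorant ν A hq hq1).of_norm_bounded (fun k => by
      rw [Real.norm_eq_abs]; exact abs_omega_term_le ν hA hq hb k 1 x)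

omit he hA hq hq1 hb in
/-- Every slice `ω(t,·)` is `2π`-periodic. -/
theorem synthOmega_periodic (t : ℝ) : Function.Periodic (synthOmega e t) (2 * π) := by
  intro x
  unfold synthOmega
  congr 1
  refine tsum_congr fun k => ?_
  rw [mul_add, show (k : ℝ) * (2 * π) = k * (2 * π) by rfl, Real.sin_add_nat_mul_two_pi]

end envelope

end SheetNSLineTorusCascade
end Summit.NavierStokesRegularity.OSWSelfSimilar
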